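import Literature.MathematicalPhysics.QuantumFieldTheory.Balaban1983to89.B16NodeKnit
import Literature.MathematicalPhysics.QuantumFieldTheory.Balaban1983to89.B14NodeKnit

/-!
# YM-DAG node N13 · [Balaban1989LargeFieldII] — THE N11 ∕ N13 INTERFACE CONTRACT IN KERNEL FORM: one 𝐑-carrier `V` whose [III] p. 244
# property `ROpLeaf V` is N13's CONCLUSION and N11's HYPOTHESIS; the variance of the two slots in the shared spaces; the ITERATE reading of
# «the corresponding assumptions» (under which N11's slot is a tautology and N13 carries the whole step); and the composition of the two
# knits — Theorem 1 along the trajectory, N11 ∧ N13 at a run, and the (B) pin `B16.EndStatementBPrinted w.C` — from the displayed slots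

TRACK-A SEAT FILE (seat `pub-ymgap-dag-n13-a`, KNIT-BY-NAME for N13; companion of `B16NodeKnit` (this seat, p409035) and `B14NodeKnit` (seat
dag-n11-a, p408840); design note `HOME/pub-ymgap-dag-n11-a/N11-PIN-LIST.md` §2 «THE N11 ∕ N13 ∕ N12 INTERFACE CONTRACT» and this seat's
`HOME/pub-ymgap-dag-n13-a/N13-PIN-LIST.md` rows R13–R14).  THEOREMS ONLY, no definition; every ingredient BY NAME.
WHAT IS HERE.  §1 VARIANCE: N13's product `ROpLeaf V` (= `B14.RAssumedP244 V.R V.Scorr V.S V.K`, [Balaban1988Convergent] p. 244) is MONOTONE in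
the Sect.-2 space `S` and ANTITONE in the «corresponding» space `Scorr`; N11's slot, the Theorem of p. 245 (`B14.ThmP245SpacesI ∕ ThmP245PrintedI`),
has the OPPOSITE variance — the kernel form of the contract's sentence «pin `V.S` too weak and N13's leaf is unprovable, too strong and N11's slot
is».  §2 THE ITERATE READING of «Tρ_k satisfies the corresponding assumptions» (p. 245, sequence reading: `Scorr (k+1) ρ′ :↔ ρ′ = T_k ρ_k ∧ ρ_k ∈ S k`
along a (0.2) trajectory `D`): N11's slot `ThmP245PrintedI` is then a TAUTOLOGY and `ROpLeaf` is EXACTLY the sequence step `ρ_k ∈ S k ⇒ ρ_{k+1} ∈ S (k+1)`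
— [III] Sects. 1–3 and [Balaban1989LargeFieldII] §1 together (= `B16.InductionStep` in `S`-currency, `rOpLeaf_iterate_of_inductionStep`) — so a Stage-5
record that wants the printed node split must pin `Scorr` in the SPACE ∕ improved-bounds reading of p. 262 (N11-PIN-LIST R9), not the iterate one.
§3 COMPOSITION: the R-slot (N13) + the T-slot (N11) + the start give Theorem 1's conclusion along the trajectory (`B14.inductiveAssumptions_of_thmP245I`
with the 𝐑-hypothesis supplied by `ROpLeaf V`, `B14NodeKnit.rAssumed_of_rOpLeaf`), hence N11 AND N13 at a run bound to the N-binding from ONE carrier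
`V` (`nodes_N11_N13_of_slots`), and §4 the PIN `B16.EndStatementBPrinted w.C` ([Balaban1989LargeFieldII] Thm 1 ∧ [III] Cor. 3 — binder B2, N24's target)
at a world from the displayed slots of the two knits plus the in-edge leaves, the small-field leaf and the located flow step (2.6) as hypotheses
(`endStatementBPrinted_of_slots`, through `DagBinding.endStatementBPrinted_of_worldsP`).
HONEST FRAMING: kernel bookkeeping (pure logic over landed modules); nothing of Bałaban's asserted or proved; N11, N13, B2 NOT discharged (every
analytic statement is a displayed hypothesis); the iterate-reading carriers are built inside statements from a given `V` and trajectory, never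
offered as objects of record; one finite T⁴ programme at fixed ε; NOT ℝ⁴ ∕ infinite volume ∕ OS ∕ mass gap ∕ Clay.
-/

noncomputable section

namespace Literature.MathematicalPhysics.QuantumFieldTheory.Balaban1983to89.B16NodeKnitContract

open DagBinding DagDischargedII

/-! ## §1. Variance of the two slots in the shared spaces `(S, Scorr)` -/

section Variance

variable (V : PrintedCarriers14R)

/-- **N13's product is monotone in `S`, antitone in `Scorr`, antitone in `K`**: if `ROpLeaf V` holds, it holds for every carrier with the same
`(P, G, R)`, a WEAKER Sect.-2 space `S′ ⊇ S`, a STRONGER corresponding space `Scorr′ ⊆ Scorr` and fewer steps `K′ ≤ K`.  Pure logic on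
`B14.RAssumedP244`. [cite: Balaban1988Convergent, p.244 (the assumed 𝐑; bookkeeping of its logical form)] -/
theorem rOpLeaf_mono {S' Scorr' : (k : ℕ) → Density V.P k V.G → Prop} {K' : ℕ} (hK : K' ≤ V.K)
    (hS : ∀ k ρ, V.S k ρ → S' k ρ) (hSc : ∀ k ρ, Scorr' k ρ → V.Scorr k ρ) (h : ROpLeaf V) :
    ROpLeaf { V with K := K', S := S', Scorr := Scorr' } :=
  fun k hk ρ' hρ' => hS _ _ (h k (lt_of_lt_of_le hk hK) ρ' (hSc _ _ hρ'))

variable {V} {av : ∀ j, Averaging V.P j V.G}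

/-- **N11's slot has the opposite variance** (space reading of the Theorem of p. 245): `B14.ThmP245SpacesI T S Scorr K` passes to a STRONGER
`S′ ⊆ S`, a WEAKER `Scorr′ ⊇ Scorr` and fewer steps.  With `rOpLeaf_mono`: no re-pinning of `(S, Scorr)` eases both nodes at once — the printed pair
([III] (2.1)–(2.42) for `S`; p. 262's improved bounds for `Scorr`) is the contract. [cite: Balaban1988Convergent, Theorem p.245 with remark p.262 (bookkeeping of its logical form)] -/
theorem thmP245SpacesI_mono {T : (k : ℕ) → RTOpI V.P k V.G (av k)} {S Scorr S' Scorr' : (k : ℕ) → Density V.P k V.G → Prop} {K K' : ℕ}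
    (hK : K' ≤ K) (hS : ∀ k ρ, S' k ρ → S k ρ) (hSc : ∀ k ρ, Scorr k ρ → Scorr' k ρ) (h : B14.ThmP245SpacesI T S Scorr K) :
    B14.ThmP245SpacesI T S' Scorr' K' :=
  fun k hk ρ hρ => hSc _ _ (h k (lt_of_lt_of_le hk hK) ρ (hS _ _ hρ))

/-- The same for the sequence reading `B14.ThmP245PrintedI T ρ S Scorr K`. [cite: Balaban1988Convergent, Theorem p.245 (bookkeeping of its logical form)] -/
theorem thmP245PrintedI_mono {T : (k : ℕ) → RTOpI V.P k V.G (av k)} {ρ : (k : ℕ) → Density V.P k V.G}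
    {S Scorr S' Scorr' : (k : ℕ) → Density V.P k V.G → Prop} {K K' : ℕ}
    (hK : K' ≤ K) (hS : ∀ k ρ, S' k ρ → S k ρ) (hSc : ∀ k ρ, Scorr k ρ → Scorr' k ρ) (h : B14.ThmP245PrintedI T ρ S Scorr K) :
    B14.ThmP245PrintedI T ρ S' Scorr' K' :=
  fun k hk hρ => hSc _ _ (h k (lt_of_lt_of_le hk hK) (hS _ _ hρ))

end Variance

/-! ## §2. The ITERATE reading of «the corresponding assumptions» collapses N11's slot and loads the whole step on N13's product -/

section Iterate

variable (V : PrintedCarriers14R) {av : ∀ j, Averaging V.P j V.G} (D : Step.DensityRGI V.P V.G av)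

/-- **Under the iterate reading, the Theorem of p. 245 (sequence reading) is a TAUTOLOGY.**  Read «Tρ_k satisfies the corresponding assumptions» as
«it is the T-image of the iterate ρ_k, which lies in the index-k space» — `Scorr (k+1) ρ′ :↔ ρ′ = T_k ρ_k ∧ ρ_k ∈ S k` along the trajectory `D`
([Balaban1988Convergent] (0.2)).  Then `B14.ThmP245PrintedI D.T D.ρ S Scorr K` holds by `rfl`, for ANY `S`: N11's analytic slot (S1) has no content in
this reading. [cite: Balaban1988Convergent, Theorem p.245 and (0.2) p.244 (a reading census, bookkeeping)] -/
theorem thmP245PrintedI_iterate (S : (k : ℕ) → Density V.P k V.G → Prop) (K : ℕ) :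
    B14.ThmP245PrintedI D.T D.ρ S
      (fun k => match k with
        | 0 => fun _ => False
        | j + 1 => fun ρ' => ρ' = (D.T j).T (D.ρ j) ∧ S j (D.ρ j)) K :=
  fun _ _ hρ => ⟨rfl, hρ⟩

/-- **Under the iterate reading, N13's product IS the sequence step.**  For the carrier `V` re-read with the iterate `Scorr` along a trajectory `D`
whose large-field operations are `V`'s: `ROpLeaf` ↔ «for every `k < K`, ρ_k ∈ S k ⇒ 𝐑_k(T_k ρ_k) ∈ S (k+1)» — i.e. [III] Sects. 1–3 (the T-analysis)
AND [Balaban1989LargeFieldII] §1 (the 𝐑-analysis) in one slot.  Pure logic. [cite: Balaban1989LargeFieldII, pp.390–391 («the result 𝐑ρ_k … can be written in the form (2.18) [III], with all the expressions satisfying the induction hypothesis»); Balaban1988Convergent, p.244 (reading census, bookkeeping)] -/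
theorem rOpLeaf_iterate_iff :
    ROpLeaf { V with
        Scorr := fun k => match k with
          | 0 => fun _ => False
          | j + 1 => fun ρ' => ρ' = (D.T j).T (D.ρ j) ∧ V.S j (D.ρ j) } ↔
      ∀ k, k < V.K → V.S k (D.ρ k) → V.S (k + 1) (V.R k ((D.T k).T (D.ρ k))) := by
  refine ⟨fun h k hk hρ => h k hk ((D.T k).T (D.ρ k)) ⟨rfl, hρ⟩, fun h k hk ρ' hρ' => ?_⟩
  obtain ⟨hEq, hρ⟩ := hρ'
  subst hEq
  exact h k hk hρ

/-- Along the trajectory the sequence step IS «ρ_k ∈ S k ⇒ ρ_{k+1} ∈ S (k+1)» (the step law `ρ_{k+1} = 𝐑_k(T_k ρ_k)` of `Step.DensityRGI` with `D.R = V.R`).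
[cite: Balaban1988Convergent, (0.2) p.244 (bookkeeping)] -/
theorem rOpLeaf_iterate_iff_succ (hR : ∀ k ρ, D.R k ρ = V.R k ρ) :
    ROpLeaf { V with
        Scorr := fun k => match k with
          | 0 => fun _ => False
          | j + 1 => fun ρ' => ρ' = (D.T j).T (D.ρ j) ∧ V.S j (D.ρ j) } ↔
      ∀ k, k < V.K → V.S k (D.ρ k) → V.S (k + 1) (D.ρ (k + 1)) := by
  rw [rOpLeaf_iterate_iff]
  refine forall_congr' fun k => forall_congr' fun _ => forall_congr' fun _ => ?_
  rw [D.step k, hR]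

/-- **N13's product in the iterate reading FROM `B16.InductionStep`** (the B16 sub-cell's typing of pp. 390–391, verbatim there: *«This new action satisfies
the induction hypothesis … the result 𝐑ρ_k of the 𝐑-operation can be written in the form (2.18) [III], with all the expressions satisfying the induction
hypothesis described in Sect. 2 [III].»*) at ONE run `P` of a construction `C`, under the interval hypothesis and the record's dictionary
«`ρ_k ∈ S k` ↔ `Sect2Form k`» (N11-PIN-LIST R10) for a trajectory with `V.K ≤ P.K`: the R-leaf of the iterate-read carrier holds.  The displayed
hypothesis `hs` is [Balaban1989LargeFieldII]'s theorem for the run — NOT proved here. [cite: Balaban1989LargeFieldII, Thm 1 p.355 and pp.390–391] -/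
theorem rOpLeaf_iterate_of_inductionStep (C : B16.Construction) (γ : ℝ) (hs : B16.InductionStep C γ) (P : B12.RunParams)
    (hsc : (C P).flow.InInterval γ P.K) (hK : V.K ≤ P.K) (hR : ∀ k ρ, D.R k ρ = V.R k ρ)
    (hdict : ∀ k, k ≤ P.K → (V.S k (D.ρ k) ↔ (C P).Sect2Form k)) :
    ROpLeaf { V with
        Scorr := fun k => match k with
          | 0 => fun _ => False
          | j + 1 => fun ρ' => ρ' = (D.T j).T (D.ρ j) ∧ V.S j (D.ρ j) } := by
  rw [rOpLeaf_iterate_iff_succ V D hR]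
  intro k hk hρ
  have hkP : k < P.K := lt_of_lt_of_le hk hK
  exact (hdict (k + 1) hkP).2 (hs P hsc k hkP ((hdict k hkP.le).1 hρ))

end Iterate

/-! ## §3. Composition of the two knits: Theorem 1 along the trajectory, and N11 ∧ N13 at a run from ONE carrier -/

section Compose

variable {w : WorldP} {P : B12.RunParams} (V : PrintedCarriers14R) {av : ∀ j, Averaging V.P j V.G} (D : Step.DensityRGI V.P V.G av)

/-- **Theorem 1's conclusion along the trajectory from the two slots**: the start `ρ₀ ∈ S 0`, N11's T-slot (Theorem of p. 245, sequence reading) and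
N13's R-slot `ROpLeaf V` (for a trajectory with `D.R = V.R`, `K ≤ V.K`) give `ρ_k ∈ S k` for every `k ≤ K` — `B14.inductiveAssumptions_of_thmP245I` with
its 𝐑-hypothesis supplied by the leaf (`B14NodeKnit.rAssumed_of_rOpLeaf`).  Pure logic; both slots displayed. [cite: Balaban1988Convergent, Thm 1 p.262 (= start + Theorem p.245 + assumed 𝐑 along (0.2)); Balaban1989LargeFieldII, Thm 1 p.355] -/
theorem inSpace_all_of_slots {K : ℕ} (hK : K ≤ V.K) (hRR : ∀ k ρ, D.R k ρ = V.R k ρ) (h0 : V.S 0 (D.ρ 0))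
    (hT : B14.ThmP245PrintedI D.T D.ρ V.S V.Scorr K) (hR : ROpLeaf V) : ∀ k, k ≤ K → V.S k (D.ρ k) :=
  B14.inductiveAssumptions_of_thmP245I D h0 hT (B14NodeKnit.rAssumed_of_rOpLeaf V D hK hRR hR)

variable {X : PrintedCarriersR} {Y : PrintedCarriers9X} {Z : PrintedCarriers11} {W : PrintedCarriers15}

/-- **N11 AND N13 at a run bound to the N-binding from ONE carrier `V`** (the contract instantiated): at `w.up P = ofPrintedAllXPN X Y Z V W`, given the
trajectory pins (`D.R = V.R`, `P.K ≤ V.K`), the dictionary «`ρ_k ∈ S k` ⇒ `Sect2Form k`» (R10), the start, N11's T-slot WITH ITS PRINTED ANTECEDENTS (in-edges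
`b7 … b11`, interval hypothesis, small-field leaf, flow control (2.6)), N13's R-slot `ROpLeaf V` and N13's Cor-3 slot, BOTH `Dag.B14_main (leavesP w P)` and
`Dag.B16_main (leavesP w P)` hold — the same `ROpLeaf V` being N13's first conjunct and the hypothesis N11 consumes (`B14NodeKnit.b14_main_ofPrintedAllXPN_of_thmP245I`,
`B16NodeKnit.b16_main_of_rOp_of_uv`).  Count-neutral: every analytic statement is a displayed hypothesis. [cite: Balaban1989LargeFieldII, Thm 1 p.355 + p.391; Balaban1988Convergent, Thm 1 p.262, Theorem p.245, p.244] -/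
theorem nodes_N11_N13_of_slots (hP : w.up P = Upstream.ofPrintedAllXPN X Y Z V W) (hK : P.K ≤ V.K) (hRR : ∀ k ρ, D.R k ρ = V.R k ρ)
    (hS : ∀ k, k ≤ P.K → V.S k (D.ρ k) → (w.C P).Sect2Form k)
    (h0 : (leavesP w P).smallCouplings → V.S 0 (D.ρ 0))
    (hT : (leavesP w P).b7 → (leavesP w P).b8 → (leavesP w P).b9 → (leavesP w P).b10 → (leavesP w P).b11 →
      (leavesP w P).smallCouplings → (leavesP w P).smallFieldInductive → (leavesP w P).flowControl →
        B14.ThmP245PrintedI D.T D.ρ V.S V.Scorr P.K)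
    (hR : ROpLeaf V)
    (huv : ((w.C P).flow.InInterval w.γ P.K → ∀ k, k ≤ P.K → (w.C P).Sect2Form k) →
      (w.C P).flow.InInterval w.γ P.K → ∀ k, k ≤ P.K → ∀ U : (w.C P).Cfg k,
        B16.UVIneq (w.C P) k U (w.em ((w.C P).flow.g k)) (w.ep ((w.C P).flow.g k))) :
    Dag.B14_main (leavesP w P) ∧ Dag.B16_main (leavesP w P) :=
  ⟨B14NodeKnit.b14_main_ofPrintedAllXPN_of_thmP245I w P V X Y Z W hP D hK hRR hS h0 hT, B16NodeKnit.b16_main_of_rOp_of_uv hP hR huv⟩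

end Compose

/-! ## §4. The (B) pin `B16.EndStatementBPrinted w.C` at a world from the displayed slots of the two knits -/

section Pin

variable (w : WorldP)

/-- **[Balaban1989LargeFieldII] Thm 1 ∧ [III] Cor. 3 — the PIN `B16.EndStatementBPrinted w.C` (binder B2) — at a binding world from the SLOTS of the N11 and N13
knits**, with the world's `γ, em, ep` as the witnesses (`DagBinding.endStatementBPrinted_of_worldsP`).  Per run `P`: a carrier `V P` and a trajectory `D P` with
the pins (`D.R = V.R`, `P.K ≤ V.K`, dictionary R10), the start (S0), N11's T-slot (S1) with its printed antecedents, N13's R-slot `ROpLeaf (V P)`; at the world: the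
five [III] p. 264 leaves over a (2.18) family `R`; and, as hypotheses, the in-edge leaves `b7 … b11` of N11 (products of N04–N08), the small-field leaf
«interval ⇒ inductive assumptions» (N09∕N10) and the located flow step (2.6) «interval ⇒ flow control» (`Dag.FlowStepPrinted`, T11.F; β-side).  Nothing analytic
is proved: Theorem 1 = (S0) + (S1) + (R) along (0.2) (`inSpace_all_of_slots`), Cor. 3 = the five leaves given Theorem 1 (`B16NodeKnit.uvSlot_of_cor3Leaves`).
[cite: Balaban1989LargeFieldII, Thm 1 p.355, p.387, p.391; Balaban1988Convergent, Thm 1 p.262, Theorem p.245, p.244, Cor. 3 (2.50) p.264] -/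
theorem endStatementBPrinted_of_slots (hγ : 0 < w.γ) (V : B12.RunParams → PrintedCarriers14R)
    (av : (P : B12.RunParams) → ∀ j, Averaging (V P).P j (V P).G) (D : (P : B12.RunParams) → Step.DensityRGI (V P).P (V P).G (av P))
    (hK : ∀ P, P.K ≤ (V P).K) (hRR : ∀ P k ρ, (D P).R k ρ = (V P).R k ρ)
    (hS : ∀ P k, k ≤ P.K → (V P).S k ((D P).ρ k) → (w.C P).Sect2Form k)
    (h0 : ∀ P, (leavesP w P).smallCouplings → (V P).S 0 ((D P).ρ 0))
    (hT : ∀ P, (leavesP w P).b7 → (leavesP w P).b8 → (leavesP w P).b9 → (leavesP w P).b10 → (leavesP w P).b11 →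
      (leavesP w P).smallCouplings → (leavesP w P).smallFieldInductive → (leavesP w P).flowControl →
        B14.ThmP245PrintedI (D P).T (D P).ρ (V P).S (V P).Scorr P.K)
    (hR : ∀ P, ROpLeaf (V P))
    (R : B14Cor3.ReprFamily w.C) (hH : B14Cor3.LeafH w.C R w.γ) (hU1 : B14Cor3.LeafU1 w.C R w.γ) (hU2 : B14Cor3.LeafU2 w.C R w.γ w.ep)
    (hL1 : B14Cor3.LeafL1 w.C R w.γ) (hL2 : B14Cor3.LeafL2 w.C R w.γ w.em)
    (hin : ∀ P, (leavesP w P).b7 ∧ (leavesP w P).b8 ∧ (leavesP w P).b9 ∧ (leavesP w P).b10 ∧ (leavesP w P).b11)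
    (hsf : ∀ P, (leavesP w P).smallCouplings → (leavesP w P).smallFieldInductive)
    (hflow : ∀ P, Dag.FlowStepPrinted (leavesP w P)) :
    B16.EndStatementBPrinted w.C := by
  refine endStatementBPrinted_of_worldsP w hγ fun P hsc => ?_
  obtain ⟨h7, h8, h9, h10, h11⟩ := hin P
  have hdd : ∀ k, k ≤ P.K → (w.C P).Sect2Form k := fun k hk =>
    hS P k hk (inSpace_all_of_slots (V P) (D P) (hK P) (hRR P) (h0 P hsc)
      (hT P h7 h8 h9 h10 h11 hsc (hsf P hsc) (hflow P hsc)) (hR P) k hk)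
  exact ⟨hdd, B16NodeKnit.uvSlot_of_cor3Leaves w R hH hU1 hU2 hL1 hL2 P (fun _ => hdd) hsc⟩

end Pin

end Literature.MathematicalPhysics.QuantumFieldTheory.Balaban1983to89.B16NodeKnitContract

end
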